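import Mathlib
import Literature.NumberTheory.LFunctions.Zhang2022.Section17R1PrimeBulkBound
import HarnessLib

/-!
# Zhang (2022) §17.u021, remainder `R₁`, piece M2L-p BULK: the final numerics — the bulk is `≤ ε`

Topic `Literature/NumberTheory/LFunctions/Zhang2022` (Landau–Siegel audit tree; verdict-neutral).
Y. Zhang, *Discrete mean estimates and the Landau–Siegel zero*, arXiv:2211.02515v1 (2022)
[Zhang2022LandauSiegel] — **an unrefereed manuscript under adjudication; nothing here asserts or denies
its Theorems 1–2, and no claim about Landau–Siegel zeros is made.** Lane ZHANG-L, WP16, leaf h17_9,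
sub-leaf `R₁` («R1Rel c′»), piece M2L-p BULK = hypothesis `hLpB` of the owner's
`Phi3Eval.step17_u021Chi_R1Rel_of_split4abs` / `eq17_9RelE_e1ppD_eventually_of_prime_pieces`
(large PRIME arguments `p` with `D⁴ < q₂p`, `p ∤ q₁`, below the cutoff `4D⁴p ≤ T²`). §17 p. 98
(tex L4825): "we can drop the terms with `m₂ > 1` … with an acceptable error" — no bound in print.

zl-w16-p3's `Phi3Eval.R1_prime_bulk_bound` (`Section17R1PrimeBulkBound`, all number theory done) bounds
the bulk, under (A) and given the `m₁`-sum majorant M1, by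
`16Cα𝓛^{1.1}·( H·(2M₄₆(log D⁴)⁴ + 8δM₁₂₈(log D⁴)¹²) + (Σ_{n<D⁴}τ₂²/n)²·log₂⌊T²/4⌋·C₃₂/𝓛²⁰⁰⁷ )`,
`H = Σ_{p≤T², 4D⁴p≤T²} 1/p`, `δ = 10α𝓛^{1.1} + ½e^{−𝓛³⁰}`. This file does the remaining ARITHMETIC:
`H ≤ 1 + log T² ≤ 3𝓛^{1.1}` (harmonic), `δ ≤ 11α𝓛^{1.1}`, `Σ_{n≤D⁴}τ₂²/n ≤ 256M₄₄𝓛⁴`,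
`log₂⌊T²/4⌋ ≤ 3𝓛^{1.1}`, `(𝓛^{1.1})² ≤ 𝓛³`, `(𝓛^{1.1})³ ≤ 𝓛⁴`, `α = π𝓛⁻⁹` — so each of the three
terms is `≤ Kᵢ𝓛⁻²`, and the bulk is `≤ ε` for `𝓛 ≥ K/ε + 1`:

* `bulk_numerics_le` — the real-variable inequality behind it (all sizes as hypotheses);
* `R1_prime_bulk_small` — **M2L-p BULK `≤ ε`** (text = `hLpB` of `step17_u021Chi_R1Rel_of_split4abs`
  VERBATIM, with zl-w16-p3's `hM1` binder; plug `m1Sum_le c'` for `hM1`).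

Theorems only; no definitions, no named facts; axioms standard.

## References

* Y. Zhang, arXiv:2211.02515v1 (2022), §17 p. 98 (u021, tex L4825); §2 (2.6), (2.10).
  [cite: Zhang2022LandauSiegel, §17 u021 p.98]
-/

noncomputable section

open Complex Real Finset ArithmeticFunction
open Literature.NumberTheory.LFunctions.Zhang2022.Skeleton
open Literature.NumberTheory.LFunctions.Zhang2022.Typed.Section17
open Literature.NumberTheory.LFunctions.Zhang2022.MeanSquareMajorant

namespace Literature.NumberTheory.LFunctions.Zhang2022.Phi3Eval

/-! ## §1. The arithmetic -/

/-- **The three terms of the bulk bound are each `≪ 𝓛⁻²`.** With `L ≥ 1`, `L ≤ u`, `u² ≤ L³`, `u³ ≤ L⁴`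
(`u = 𝓛^{1.1}`), `a = π/L⁹` (`α`), `0 ≤ C`, `H ≤ 3u`, `0 ≤ δ ≤ 11au`, `0 ≤ τs ≤ 256·M₄₄·L⁴`,
`0 ≤ NL ≤ 3u`, `M₄₆, M₁₂₈ ≥ 0`:
`16Cau·(H·(2M₄₆(4L)⁴ + 8δM₁₂₈(4L)¹²) + τs²·NL·(C₃₂/L²⁰⁰⁷)) ≤ (K₁+K₂+K₃)/L²` — the arithmetic of the
three error terms of §17.u021's dropped `m₂ > 1` sum (bulk range). [cite: Zhang2022LandauSiegel, §17 u021 p.98] -/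
theorem bulk_numerics_le {L u a H δ τs NL C C32 M46 M128 M44 : ℝ} (hL : 1 ≤ L) (hLu : L ≤ u)
    (hu2 : u ^ 2 ≤ L ^ 3) (hu3 : u ^ 3 ≤ L ^ 4) (ha : a = Real.pi / L ^ 9) (hC : 0 ≤ C)
    (hH : H ≤ 3 * u) (hδ0 : 0 ≤ δ) (hδ : δ ≤ 11 * a * u) (hτ0 : 0 ≤ τs)
    (hτ : τs ≤ 256 * M44 * L ^ 4) (hNL0 : 0 ≤ NL) (hNL : NL ≤ 3 * u) (hM46 : 0 ≤ M46)
    (hM128 : 0 ≤ M128) :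
    16 * C * a * u *
        (H * (2 * (M46 * (4 * L) ^ 4) + 8 * δ * (M128 * (4 * L) ^ 12)) +
          τs ^ 2 * (NL * (C32 / L ^ 2007))) ≤
      (24576 * Real.pi * C * M46 + 4224 * 4 ^ 12 * Real.pi ^ 2 * C * M128 +
        3145728 * Real.pi * C * M44 ^ 2 * |C32|) / L ^ 2 := by
  have hL0 : 0 < L := by linarith
  have hu0 : 0 ≤ u := by linarith
  have hπ := Real.pi_pos
  have ha0 : 0 ≤ a := by rw [ha]; positivity
  have hLne : L ≠ 0 := hL0.ne'
  -- the three size facts in `α`, `u`, `L`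
  have hs1 : a * u ^ 2 * L ^ 4 ≤ Real.pi / L ^ 2 := by
    rw [ha]
    have h : Real.pi / L ^ 9 * u ^ 2 * L ^ 4 = Real.pi * (u ^ 2 * L ^ 4) / L ^ 9 := by ring
    rw [h]
    calc Real.pi * (u ^ 2 * L ^ 4) / L ^ 9 ≤ Real.pi * (L ^ 3 * L ^ 4) / L ^ 9 := by
          gcongr
      _ = Real.pi / L ^ 2 := by field_simp
  have hs2 : a ^ 2 * u ^ 3 * L ^ 12 ≤ Real.pi ^ 2 / L ^ 2 := by
    rw [ha]
    have h : (Real.pi / L ^ 9) ^ 2 * u ^ 3 * L ^ 12 = Real.pi ^ 2 * (u ^ 3 * L ^ 12) / L ^ 18 := by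
      field_simp
    rw [h]
    calc Real.pi ^ 2 * (u ^ 3 * L ^ 12) / L ^ 18 ≤ Real.pi ^ 2 * (L ^ 4 * L ^ 12) / L ^ 18 := by
          gcongr
      _ = Real.pi ^ 2 / L ^ 2 := by field_simp
  have hs3 : a * u ^ 2 * L ^ 8 / L ^ 2007 ≤ Real.pi / L ^ 2 := by
    rw [ha]
    have h : Real.pi / L ^ 9 * u ^ 2 * L ^ 8 / L ^ 2007 = Real.pi * (u ^ 2 * L ^ 8) / L ^ 2016 := by
      field_simp
    rw [h]
    have h13 : L ^ 13 ≤ L ^ 2016 := pow_le_pow_right₀ hL (by norm_num)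
    calc Real.pi * (u ^ 2 * L ^ 8) / L ^ 2016 ≤ Real.pi * (L ^ 3 * L ^ 8) / L ^ 2016 := by
          gcongr
      _ = Real.pi * L ^ 11 / L ^ 2016 := by ring
      _ ≤ Real.pi * L ^ 11 / L ^ 13 := by
          refine div_le_div_of_nonneg_left (by positivity) (by positivity) h13
      _ = Real.pi / L ^ 2 := by field_simp
  -- term 1
  have ht1 : 16 * C * a * u * (H * (2 * (M46 * (4 * L) ^ 4))) ≤ 24576 * Real.pi * C * M46 / L ^ 2 := by
    calc 16 * C * a * u * (H * (2 * (M46 * (4 * L) ^ 4)))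
        ≤ 16 * C * a * u * ((3 * u) * (2 * (M46 * (4 * L) ^ 4))) := by
          gcongr
      _ = 24576 * C * M46 * (a * u ^ 2 * L ^ 4) := by ring
      _ ≤ 24576 * C * M46 * (Real.pi / L ^ 2) := mul_le_mul_of_nonneg_left hs1 (by positivity)
      _ = 24576 * Real.pi * C * M46 / L ^ 2 := by ring
  -- term 2
  have ht2 : 16 * C * a * u * (H * (8 * δ * (M128 * (4 * L) ^ 12))) ≤
      4224 * 4 ^ 12 * Real.pi ^ 2 * C * M128 / L ^ 2 := by
    calc 16 * C * a * u * (H * (8 * δ * (M128 * (4 * L) ^ 12)))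
        ≤ 16 * C * a * u * ((3 * u) * (8 * (11 * a * u) * (M128 * (4 * L) ^ 12))) := by
          gcongr
      _ = 4224 * 4 ^ 12 * C * M128 * (a ^ 2 * u ^ 3 * L ^ 12) := by ring
      _ ≤ 4224 * 4 ^ 12 * C * M128 * (Real.pi ^ 2 / L ^ 2) :=
          mul_le_mul_of_nonneg_left hs2 (by positivity)
      _ = 4224 * 4 ^ 12 * Real.pi ^ 2 * C * M128 / L ^ 2 := by ring
  -- term 3
  have ht3 : 16 * C * a * u * (τs ^ 2 * (NL * (C32 / L ^ 2007))) ≤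
      3145728 * Real.pi * C * M44 ^ 2 * |C32| / L ^ 2 := by
    have hX0 : 0 ≤ 3 * u * (|C32| / L ^ 2007) := by positivity
    have hin : NL * (C32 / L ^ 2007) ≤ 3 * u * (|C32| / L ^ 2007) := by
      calc NL * (C32 / L ^ 2007) ≤ NL * (|C32| / L ^ 2007) := by
            gcongr; exact le_abs_self _
        _ ≤ 3 * u * (|C32| / L ^ 2007) := by gcongr
    have hsq : τs ^ 2 ≤ (256 * M44 * L ^ 4) ^ 2 := pow_le_pow_left₀ hτ0 hτ 2
    calc 16 * C * a * u * (τs ^ 2 * (NL * (C32 / L ^ 2007)))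
        ≤ 16 * C * a * u * (τs ^ 2 * (3 * u * (|C32| / L ^ 2007))) := by
          refine mul_le_mul_of_nonneg_left (mul_le_mul_of_nonneg_left hin (sq_nonneg _)) ?_
          positivity
      _ ≤ 16 * C * a * u * ((256 * M44 * L ^ 4) ^ 2 * (3 * u * (|C32| / L ^ 2007))) := by
          refine mul_le_mul_of_nonneg_left (mul_le_mul_of_nonneg_right hsq hX0) ?_
          positivity
      _ = 3145728 * C * M44 ^ 2 * |C32| * (a * u ^ 2 * L ^ 8 / L ^ 2007) := by ring
      _ ≤ 3145728 * C * M44 ^ 2 * |C32| * (Real.pi / L ^ 2) :=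
          mul_le_mul_of_nonneg_left hs3 (by positivity)
      _ = 3145728 * Real.pi * C * M44 ^ 2 * |C32| / L ^ 2 := by ring
  -- assemble
  have hsplit : 16 * C * a * u *
        (H * (2 * (M46 * (4 * L) ^ 4) + 8 * δ * (M128 * (4 * L) ^ 12)) +
          τs ^ 2 * (NL * (C32 / L ^ 2007))) =
      16 * C * a * u * (H * (2 * (M46 * (4 * L) ^ 4))) +
        16 * C * a * u * (H * (8 * δ * (M128 * (4 * L) ^ 12))) +
        16 * C * a * u * (τs ^ 2 * (NL * (C32 / L ^ 2007))) := by ring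
  rw [hsplit, add_div, add_div]
  exact add_le_add (add_le_add ht1 ht2) ht3

/-! ## §2. The sizes at a large modulus -/

section Sizes

variable {D : ℕ}

/-- `𝓛 ≤ 𝓛^{11/10}`, `(𝓛^{11/10})² ≤ 𝓛³`, `(𝓛^{11/10})³ ≤ 𝓛⁴` for `𝓛 ≥ 1`.
[cite: Zhang2022LandauSiegel, §2 (2.10)] -/
theorem ell_rpow_facts (hℓ1 : 1 ≤ ell D) :
    ell D ≤ ell D ^ (11 / 10 : ℝ) ∧ (ell D ^ (11 / 10 : ℝ)) ^ 2 ≤ ell D ^ 3 ∧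
      (ell D ^ (11 / 10 : ℝ)) ^ 3 ≤ ell D ^ 4 := by
  have hℓ0 : 0 ≤ ell D := by linarith
  refine ⟨?_, ?_, ?_⟩
  · have h := Real.rpow_le_rpow_of_exponent_le hℓ1 (show (1 : ℝ) ≤ 11 / 10 by norm_num)
    rwa [Real.rpow_one] at h
  · rw [← Real.rpow_natCast (ell D ^ (11 / 10 : ℝ)) 2, ← Real.rpow_mul hℓ0]
    have h := Real.rpow_le_rpow_of_exponent_le hℓ1 (show (11 / 10 : ℝ) * (2 : ℕ) ≤ (3 : ℕ) by norm_num)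
    rwa [Real.rpow_natCast (ell D) 3] at h
  · rw [← Real.rpow_natCast (ell D ^ (11 / 10 : ℝ)) 3, ← Real.rpow_mul hℓ0]
    have h := Real.rpow_le_rpow_of_exponent_le hℓ1 (show (11 / 10 : ℝ) * (3 : ℕ) ≤ (4 : ℕ) by norm_num)
    rwa [Real.rpow_natCast (ell D) 4] at h

/-- `T² = e^{2𝓛^{11/10}}`. [cite: Zhang2022LandauSiegel, §2 (2.10)] -/
theorem bigT_sq_eq_exp (D : ℕ) : bigT D ^ 2 = Real.exp (2 * ell D ^ (11 / 10 : ℝ)) := by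
  rw [bigT, ← Real.exp_nat_mul]
  norm_num

/-- **The harmonic bound for the prime sum**: `Σ_{p ≤ T², p prime, 4D⁴p ≤ T²} 1/p ≤ 1 + 2𝓛^{11/10}`.
[cite: Zhang2022LandauSiegel, §17 u021 p.98] -/
theorem sum_inv_primes_le (D : ℕ) :
    ∑ p ∈ (Finset.range (⌊bigT D ^ 2⌋₊ + 1)).filter
        (fun p : ℕ => p.Prime ∧ 4 * (D : ℝ) ^ 4 * p ≤ bigT D ^ 2), (1 : ℝ) / p ≤
      1 + 2 * ell D ^ (11 / 10 : ℝ) := by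
  classical
  set Y : ℕ := ⌊bigT D ^ 2⌋₊ with hY
  have hsub : (Finset.range (Y + 1)).filter (fun p : ℕ => p.Prime ∧ 4 * (D : ℝ) ^ 4 * p ≤ bigT D ^ 2) ⊆
      Finset.Icc 1 Y := by
    intro p hp
    rw [Finset.mem_filter, Finset.mem_range] at hp
    rw [Finset.mem_Icc]
    exact ⟨hp.2.1.one_lt.le, by omega⟩
  have hu0 : 0 ≤ ell D ^ (11 / 10 : ℝ) := Real.rpow_nonneg (Real.log_natCast_nonneg D) _
  calc ∑ p ∈ (Finset.range (Y + 1)).filter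
          (fun p : ℕ => p.Prime ∧ 4 * (D : ℝ) ^ 4 * p ≤ bigT D ^ 2), (1 : ℝ) / p
      ≤ ∑ n ∈ Finset.Icc 1 Y, (1 : ℝ) / n :=
        Finset.sum_le_sum_of_subset_of_nonneg hsub fun n _ _ => by positivity
    _ = ∑ n ∈ Finset.Icc 1 Y, tau 1 n / n := by
        refine Finset.sum_congr rfl fun n hn => ?_
        rw [tau_one_apply (by have := (Finset.mem_Icc.mp hn).1; omega)]
    _ ≤ 1 + Real.log Y := sum_tau_one_div_Icc_le Y
    _ ≤ 1 + 2 * ell D ^ (11 / 10 : ℝ) := by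
        rcases Nat.eq_zero_or_pos Y with h0 | hpos
        · rw [h0]; simp; linarith
        · have hYle : (Y : ℝ) ≤ bigT D ^ 2 := by rw [hY]; exact Nat.floor_le (by positivity)
          have hYpos : (0 : ℝ) < Y := by exact_mod_cast hpos
          have := Real.log_le_log hYpos hYle
          rw [bigT_sq_eq_exp, Real.log_exp] at this
          linarith

/-- **`log₂⌊T²/4⌋ ≤ 3𝓛^{11/10}`** (`2^{log₂X} ≤ X ≤ T²`, `log 2 > 2/3`).
[cite: Zhang2022LandauSiegel, §2 (2.10)] -/
theorem natLog_two_floor_le (D : ℕ) :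
    (Nat.log 2 ⌊bigT D ^ 2 / 4⌋₊ : ℝ) ≤ 3 * ell D ^ (11 / 10 : ℝ) := by
  set X : ℕ := ⌊bigT D ^ 2 / 4⌋₊ with hX
  have hu0 : 0 ≤ ell D ^ (11 / 10 : ℝ) := Real.rpow_nonneg (Real.log_natCast_nonneg D) _
  rcases Nat.eq_zero_or_pos X with h0 | hpos
  · rw [h0, Nat.log_zero_right]; simp; linarith
  · have h2 : (2 : ℝ) ^ Nat.log 2 X ≤ X := by exact_mod_cast Nat.pow_log_le_self 2 hpos.ne'
    have hXle : (X : ℝ) ≤ bigT D ^ 2 := by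
      have h4 : (X : ℝ) ≤ bigT D ^ 2 / 4 := by rw [hX]; exact Nat.floor_le (by positivity)
      have := sq_nonneg (bigT D)
      linarith
    have hlog : (Nat.log 2 X : ℝ) * Real.log 2 ≤ 2 * ell D ^ (11 / 10 : ℝ) := by
      rw [← Real.log_pow]
      calc Real.log ((2 : ℝ) ^ Nat.log 2 X) ≤ Real.log X := Real.log_le_log (by positivity) h2
        _ ≤ Real.log (bigT D ^ 2) := Real.log_le_log (by exact_mod_cast hpos) hXle
        _ = 2 * ell D ^ (11 / 10 : ℝ) := by rw [bigT_sq_eq_exp, Real.log_exp]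
    have hlog2 : (0.6931471803 : ℝ) < Real.log 2 := Real.log_two_gt_d9
    nlinarith

/-- `Σ_{1≤n<D⁴} τ₂(n)²/n ≤ 256·M₄₄·𝓛⁴` (`D ≥ 2`; the divisor count `Σ τ₂(m)²/m ≪ (log x)⁴`).
[cite: IwaniecKowalski2004, §1.6 (1.80)] -/
theorem sum_Ico_tau_sq_div_le (hD2 : 2 ≤ D) :
    ∑ n ∈ Finset.Ico 1 (D ^ 4), tau 2 n ^ 2 / (n : ℝ) ≤ 256 * majorantConst 4 4 * ell D ^ 4 := by
  have hX2 : 2 ≤ D ^ 4 := le_trans hD2 (Nat.le_self_pow (by norm_num) D)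
  have hlog : Real.log ((D ^ 4 : ℕ) : ℝ) = 4 * ell D := by
    rw [ell]; push_cast; rw [Real.log_pow]; push_cast; ring
  calc ∑ n ∈ Finset.Ico 1 (D ^ 4), tau 2 n ^ 2 / (n : ℝ)
      ≤ ∑ n ∈ Finset.Icc 1 (D ^ 4), tau 2 n ^ 2 / (n : ℝ) :=
        Finset.sum_le_sum_of_subset_of_nonneg Finset.Ico_subset_Icc_self fun n _ _ =>
          div_nonneg (sq_nonneg _) (Nat.cast_nonneg _)
    _ ≤ majorantConst (2 ^ 2) (2 * 2) * Real.log ((D ^ 4 : ℕ) : ℝ) ^ (2 ^ 2) := sum_tau_sq_div_le 2 hX2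
    _ = 256 * majorantConst 4 4 * ell D ^ 4 := by rw [hlog]; norm_num; ring

end Sizes

/-- Threshold: `M ≤ 𝓛` for all large `D`. [folklore] -/
private theorem exists_forall_le_ell' (M : ℝ) : ∃ D₀ : ℕ, ∀ D : ℕ, D₀ ≤ D → M ≤ ell D := by
  refine ⟨⌈Real.exp M⌉₊ + 1, fun D hD => ?_⟩
  have h1 : Real.exp M ≤ D := by
    have : (⌈Real.exp M⌉₊ : ℝ) + 1 ≤ D := by exact_mod_cast hD
    linarith [Nat.le_ceil (Real.exp M)]
  have hD0 : (0 : ℝ) < D := lt_of_lt_of_le (Real.exp_pos M) h1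
  rw [ell, Real.le_log_iff_exp_le hD0]
  exact h1

/-! ## §3. The bulk is `≤ ε` -/

/-- **M2L-p BULK, `≤ ε`.** Given the `m₁`-sum majorant M1 (`hM1`, discharged by zl-w11-p3's
`m1Sum_le c′`): for every `ε > 0`, for all large `D`, every real primitive `χ (mod D)` with (A),
`Σ_{l<D⁴} |ν(l)|/l · Σ_{l=q₁q₂} Σ'_{m₁} Σ'_{p : D⁴<q₂p, p prime, p∤q₁, 4D⁴p≤T²}
|b(q₁m₁)|·|ν₁*(q₂p)|·|κ̄₂(m₁p)|/(m₁p) ≤ ε`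
— the text of the hypothesis `hLpB` of `step17_u021Chi_R1Rel_of_split4abs` VERBATIM. From zl-w16-p3's
`R1_prime_bulk_bound` by the arithmetic of §§1–2: the bound is `≤ K𝓛⁻²`.
[cite: Zhang2022LandauSiegel, §17 u021 p.98] -/
theorem R1_prime_bulk_small (c' : ℝ)
    (hM1 : ∃ C : ℝ, ForAllLarge fun D _ _ => ∀ q₁ m₂ : ℕ, 1 ≤ q₁ → 1 ≤ m₂ →
      (∑' m₁ : ℕ, ‖bcoef D (q₁ * m₁)‖ * ‖kappa2bar c' D (m₁ * m₂)‖ / (m₁ : ℝ)) ≤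
        C * (q₁.divisors.card : ℝ) * ‖kappa2bar c' D m₂‖ * ((m₂ : ℝ) / m₂.totient) ^ 2) :
    ∀ ε : ℝ, 0 < ε → ForAllLarge fun D _ χ => AssumptionA D χ →
      ∑ l ∈ Finset.Ico 1 (D ^ 4), ‖nu χ l‖ / l *
        ∑ q ∈ l.divisorsAntidiagonal, ∑' m₁ : ℕ, ∑' p : ℕ,
          (if (D : ℝ) ^ 4 < q.2 * p ∧ p.Prime ∧ ¬ p ∣ q.1 ∧ 4 * (D : ℝ) ^ 4 * p ≤ bigT D ^ 2 then
            ‖bcoef D (q.1 * m₁)‖ * ‖nuOneStar c' χ (q.2 * p)‖ * ‖kappa2bar c' D (m₁ * p)‖ /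
              ((m₁ : ℝ) * p) else 0) ≤ ε := by
  intro ε hε
  obtain ⟨C, hC0, C₃₂, hB⟩ := R1_prime_bulk_bound c' hM1
  obtain ⟨D₁, hD₁⟩ := hB
  -- the constant
  set K : ℝ := 24576 * Real.pi * C * majorantConst 4 6 +
      4224 * 4 ^ 12 * Real.pi ^ 2 * C * majorantConst 12 8 +
      3145728 * Real.pi * C * majorantConst 4 4 ^ 2 * |C₃₂| with hK
  have hM46 : 0 ≤ majorantConst 4 6 := (majorantConst_pos _ _).le
  have hM128 : 0 ≤ majorantConst 12 8 := (majorantConst_pos _ _).le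
  have hK0 : 0 ≤ K := by rw [hK]; positivity
  obtain ⟨D₂, hD₂⟩ := hE_thresholds c' K ε hε
  obtain ⟨D₃, hD₃⟩ := exists_forall_le_ell' (K / ε)
  refine ⟨max D₁ (max D₂ D₃), fun D _ χ hD hq hp hA => ?_⟩
  have hD1 : D₁ ≤ D := le_trans (le_max_left _ _) hD
  have hD2 : D₂ ≤ D := le_trans (le_trans (le_max_left _ _) (le_max_right _ _)) hD
  have hD3 : D₃ ≤ D := le_trans (le_trans (le_max_right _ _) (le_max_right _ _)) hD
  obtain ⟨hℓ3, -, -, hsmall, -⟩ := hD₂ D hD2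
  have hKℓ' : K / ε ≤ ell D := hD₃ D hD3
  have hℓ1 : 1 ≤ ell D := by linarith
  have hℓ0 : 0 < ell D := by linarith
  have hπ := Real.pi_pos
  have hα : alpha D = Real.pi / ell D ^ 9 := by rw [alpha, bigP, Real.log_exp]
  have hα0 : 0 < alpha D := by rw [hα]; positivity
  -- `D ≥ 2`
  have hDge2 : 2 ≤ D := by
    by_contra h
    have hD1' : (D : ℝ) ≤ 1 := by exact_mod_cast (by omega : D ≤ 1)
    have : ell D ≤ 0 := Real.log_nonpos (Nat.cast_nonneg D) hD1'
    linarith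
  -- the sizes
  obtain ⟨hLu, hu2, hu3⟩ := ell_rpow_facts hℓ1
  set u : ℝ := ell D ^ (11 / 10 : ℝ) with hu
  have hH := sum_inv_primes_le D
  rw [← hu] at hH
  have hH' : ∑ p ∈ (Finset.range (⌊bigT D ^ 2⌋₊ + 1)).filter
        (fun p : ℕ => p.Prime ∧ 4 * (D : ℝ) ^ 4 * p ≤ bigT D ^ 2), (1 : ℝ) / p ≤ 3 * u := by
    have hu1 : 1 ≤ u := le_trans hℓ1 hLu
    linarith
  have hδ0 : 0 ≤ 10 * alpha D * u + (1 / 2 : ℝ) * Real.exp (-(ell D ^ 30)) := by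
    have : 0 ≤ u := by linarith
    positivity
  have hδ : 10 * alpha D * u + (1 / 2 : ℝ) * Real.exp (-(ell D ^ 30)) ≤ 11 * alpha D * u := by
    have h1 : alpha D * ell D ≤ alpha D * u := mul_le_mul_of_nonneg_left hLu hα0.le
    linarith
  have hτ0 : 0 ≤ ∑ n ∈ Finset.Ico 1 (D ^ 4), tau 2 n ^ 2 / (n : ℝ) :=
    Finset.sum_nonneg fun n _ => div_nonneg (sq_nonneg _) (Nat.cast_nonneg _)
  have hτ := sum_Ico_tau_sq_div_le hDge2
  have hNL0 : 0 ≤ (Nat.log 2 ⌊bigT D ^ 2 / 4⌋₊ : ℝ) := Nat.cast_nonneg _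
  have hNL : (Nat.log 2 ⌊bigT D ^ 2 / 4⌋₊ : ℝ) ≤ 3 * u := natLog_two_floor_le D
  have hlogX : Real.log ((D ^ 4 : ℕ) : ℝ) = 4 * ell D := by
    rw [ell]; push_cast; rw [Real.log_pow]; push_cast; ring
  have hlogD : Real.log (D : ℝ) = ell D := rfl
  -- the bound of record, then the arithmetic
  have hmain := hD₁ D χ hD1 hq hp hA
  rw [hlogX, hlogD] at hmain
  have hnum := bulk_numerics_le (C32 := C₃₂) hℓ1 hLu hu2 hu3 hα hC0 hH' hδ0 hδ hτ0 hτ hNL0 hNL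
    hM46 hM128
  rw [← hK] at hnum
  -- `K/𝓛² ≤ K/𝓛 ≤ ε`
  have hKℓ : K / ell D ^ 2 ≤ ε := by
    have h1 : K / ell D ^ 2 ≤ K / ell D :=
      div_le_div_of_nonneg_left hK0 hℓ0 (by nlinarith)
    have h2 : K / ell D ≤ ε := by
      rw [div_le_iff₀ hℓ0]
      rw [div_le_iff₀ hε] at hKℓ'
      linarith
    exact h1.trans h2
  exact hmain.trans (hnum.trans hKℓ)

end Literature.NumberTheory.LFunctions.Zhang2022.Phi3Eval
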